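/-
Copyright (c) 2026 the pub-hodgecm-mathlib formalisation cell (harness21).  Prover seat hodgecm-mathlib-LH4-p13 (g2), req620 Track A «(D-RAM) FOUR-FRAME» squad
(heir LEAD F0P3a-plan lineage; dealer LH4-plan lineage; MS ROAD A, Stage B: the B9-0₂ UNIQUENESS half on the type-2 on-branch strata (LH4-p11 (g2) 00:18:34Z cut), AXIS 1).  2026-09-04.
-/
import Summits.HodgeConjecture.HodgeConjecture.Theorems.F0P3cDyRamDiagonalSplitCountTwoAxisOne   -- ★ B4₂ FILE 3 p856197 (this seat): axis 1, type 2 (`not_two_dvd_of_isTypeTwoPolarisable_latt_axis1`); brings ★ B4 axis 1, ★ Tools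
import Summits.HodgeConjecture.HodgeConjecture.Theorems.F0P3cDyRamDiagonalSplitCountSockets   -- ★ B4 FILE 5 p856064 (this seat): `hasAxis_axis1_iff`; brings ★ StrataDefs (`HasAxis`, `stratumTwo`)
import HarnessLib

/-!
# Crux `H413`, MS ROAD A, STAGE B — B9-0₂ ON THE AXIS-1 STRATUM: THE TYPE-2 POLARISATIONS OF `M₁(s,z)` FORM ONE `S_F`-COSET (`n₂(M) = 1`, MEMO v2.1 §T2.2)

Cell `hodgecm-mathlib` (D-0151), FLOOR 0, crux item H413 = `stmt-HodgeConjecture-24833`, route of record `HCCMUnconditional`; squad F0∕P3c∕LH4 (req618∕req620).  THEOREMS ONLY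
(no `def`, no instance, no notation, no `sorry`, default heartbeats); lane `--supports stmt-HodgeConjecture-24833 --as helper` (count-neutral).  Road target: tree
`Cruxes/H413/Lines/F0_P3c_DyRamFourFrame_U3_Laws.lean` stub `stub_U3_stableModelSum` (MS), type-2 half: Stage A (O2c) at `tv = 2` needs the `hcoset` binder «the type-2
polarisations of `M₀` form ONE coset of `S_F(M₀)`» for every `M₀ ∈ 𝓛₀(T)`; ★ B9-0 p856086 (`F0P3cDyRamDiagonalPolarisationCoset`, LH4-p11 (g2)) proved the «⊇» half for every lattice
and reduced the binder to per-stratum UNIQUENESS: `∀ D₁ D, (fixed, non-zero) → IsVertexLattice σ ϖ (diag D₁) 2 M → … → IsVertexLattice σ ϖ (diag D) 2 M → ∃ u ∈ S_F(M), ∀ i, D i = D₁ i · u i`.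
THIS FILE proves that uniqueness on the AXIS-1 on-branch stratum `M = M₁(s,z) = latt (1 0 0; 0 1 0; 0 z ϖ^s)` (`z` a unit) — the coordinate twin `(0 1 2) ↦ (1 2 0)` of the axis-3 file
`F0P3cDyRamDiagonalSplitCountTwoUnique` (MEMO v2.1 §T2.2 `T₁(s)`): the solution set is `u₀, u₂` free, `u₁ ≡ −u₂N(z) (𝔭_F^{(s+1)∕2})`, ONE coset of `S_F = {u : u₂ ≡ u₁ (𝔭^s)}`.

WHAT IS PROVED (generic valued field `K`; datum letters as in ★ B1).
* §1 `exponents_of_isVertexLattice_two_latt_axis1` — for ANY type-2 polarisation `diag(D)` of `M₁(s,z)`: `s` is odd and `|D₁| = |D₂| = |ϖ|^{1−s}`, `|D₀| = 1`,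
  `|D₁ + N(z)D₂| ≤ |ϖ|` — read off the Gram matrix on the HNF frame (★ `isVertexLattice_latt_iff_of_v`: `G`, `ϖG⁻¹` (explicit inverse), `|det G| = |ϖ|²`) and the parity of fixed elements.
* §2 HEAD **`typeTwoPolarisation_unique_latt_axis1`** — two polarisations `D₁`, `D` differ by `u = D∕D₁ ∈ S_F(M₁(s,z))`: `u` is a `σ`-fixed unit vector by §1, and
  `(u₂ − u₁)·D₁,₁D₁,₂ = D₂·g₁ − g·D₁,₂` with `g, g₁` the two `G₁₁`'s gives `|u₂ − u₁| ≤ |ϖ|^s`, i.e. `u ∈ S_F` (★ `mem_fixedUnitStabilizer_latt_axis1_iff`);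
* §3 sockets `typeTwoPolarisation_unique_of_hasAxis_T1` (every `M ∈ 𝓛₀(T)` with `HasAxis ϖ M (0,s,s)`, via ★ `hasAxis_axis1_iff`) and `typeTwoPolarisation_unique_stratumTwo_T1`
  (every `M ∈ stratumTwo σ ϖ T (0,s,s)`, ★ StrataDefs ED. 2).
HONEST LABEL.  Count-neutral (`--supports`); nothing printed is asserted; (MS) and the census laws stay PROVER TARGETS until the Stage B bricks and B10∕B10₂ land; `HC_CM` is proved only
modulo the 7 printed citations (2 remaining named inputs: hLiu418 = `stmt-HodgeConjecture-24832`, h413 = `stmt-HodgeConjecture-24833`) until rung 0 closes.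

## References
* [Kottwitz1986BaseChangeUnits] R. E. Kottwitz, *Base change for unit elements of Hecke algebras*, Compositio Math. 60 (1986), §1 pp. 240–241.
* [Rogawski1990] J. D. Rogawski, *Automorphic Representations of Unitary Groups in Three Variables*, Ann. of Math. Stud. 123 (1990), §4.9 Prop. 4.9.1 (a) p. 55.
* [Jacobowitz1962] R. Jacobowitz, *Hermitian forms over local fields*, Amer. J. Math. 84 (1962), §7–§8 (`𝔭`-modular lattices).
-/

set_option autoImplicit false

noncomputable section

namespace Summit.HodgeConjecture.HodgeConjecture.Cruxes.H413.F0P3cDyRamDiagonalSplitCountTwoUniqueAxisOne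

open Matrix
open Literature.NumberTheory.Automorphic Literature.NumberTheory.Automorphic.HermitianLattice
open Literature.NumberTheory.Automorphic.UnitaryLatticeTree
open Literature.NumberTheory.LocalFields.WildQuadraticDatum (v_varpi_pow)
open Summit.HodgeConjecture.HodgeConjecture.Cruxes.H413.F0P3cDyRamDiagonalTorusDefs
open Summit.HodgeConjecture.HodgeConjecture.Cruxes.H413.F0P3cDyRamDiagonalSplitCountAxisOne
open Summit.HodgeConjecture.HodgeConjecture.Cruxes.H413.F0P3cDyRamDiagonalSplitCountTwoAxisOne
open Summit.HodgeConjecture.HodgeConjecture.Cruxes.H413.F0P3cDyRamDiagonalStrataDefs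
open Summit.HodgeConjecture.HodgeConjecture.Cruxes.H413.F0P3cDyRamDiagonalSplitCountSockets (hasAxis_axis1_iff)
open Summit.HodgeConjecture.HodgeConjecture.Cruxes.H413.F0P3cDyRamDiagonalGluedTubeCriterion (formCongr_hnf_diagonal det_coe_hnf det_formCongr_diagonal)
open scoped Valued WithZero Matrix MatrixGroups

variable {K : Type*} [Field K] [Valued K ℤᵐ⁰]

/-! ## §1  The valuations of a type-2 polarisation of `M₁(s,z)` are forced -/

/-- **THE EXPONENTS OF A TYPE-2 POLARISATION OF `M₁(s,z)`.**  If `M₁(s,z)` (`z` a unit) is a type-2 vertex lattice for the `σ`-fixed non-degenerate `diag(D)`, then `s` is odd,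
`|D₁| = |D₂| = exp(s − 1)` (`= |ϖ|^{1−s}`), `|D₀| = 1`, and the Gram entry `G₁₁ = D₁ + N(z)D₂` satisfies `|G₁₁| ≤ exp(−1)` (from `ϖ·G₁₁∕det' ∈ 𝒪`). [cite: Jacobowitz1962, §7–§8] -/
theorem exponents_of_isVertexLattice_two_latt_axis1 {σ : K →+* K} (hvσ : ∀ a, Valued.v (σ a) = Valued.v a)
    (hfix : ∀ x : K, σ x = x → x ≠ 0 → ∃ n : ℤ, Valued.v x = WithZero.exp (2 * n)) {ϖ : K} (hϖ : Valued.v ϖ = WithZero.exp (-1 : ℤ))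
    {z : K} (hz : Valued.v z = 1) {s : ℕ} {D : Fin 3 → K} (hD : ∀ i, σ (D i) = D i ∧ D i ≠ 0)
    (hV : IsVertexLattice σ ϖ (Matrix.diagonal D) 2 (latt (!![1, 0, 0; 0, 1, 0; 0, z, ϖ ^ s] : Matrix (Fin 3) (Fin 3) K))) :
    ¬ 2 ∣ s ∧ Valued.v (D 0) = 1 ∧ Valued.v (D 1) = WithZero.exp ((s : ℤ) - 1) ∧ Valued.v (D 2) = WithZero.exp ((s : ℤ) - 1) ∧
      Valued.v (D 1 + σ z * D 2 * z) ≤ WithZero.exp (-1 : ℤ) := by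
  have hodd : ¬ 2 ∣ s := not_two_dvd_of_isTypeTwoPolarisable_latt_axis1 hvσ hfix hϖ hz ⟨D, hD, hV⟩
  have hϖ0 : ϖ ≠ 0 := fun h0 => by rw [h0, map_zero] at hϖ; exact WithZero.coe_ne_zero hϖ.symm
  have hσz : Valued.v (σ z) = 1 := by rw [hvσ, hz]
  have hvs : Valued.v (ϖ ^ s) = WithZero.exp (-(s : ℤ)) := by rw [map_pow, v_varpi_pow hϖ]
  have hσs : Valued.v (σ (ϖ ^ s)) = WithZero.exp (-(s : ℤ)) := by rw [hvσ, hvs]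
  obtain ⟨n₀, hn₀⟩ := hfix (D 0) (hD 0).1 (hD 0).2
  obtain ⟨n₁, hn₁⟩ := hfix (D 1) (hD 1).1 (hD 1).2
  obtain ⟨n₂, hn₂⟩ := hfix (D 2) (hD 2).1 (hD 2).2
  set g : GL (Fin 3) K := Matrix.GeneralLinearGroup.mkOfDetNeZero _ (det_axis1_ne_zero hϖ0 z s) with hg
  have hG : formCongr σ g (Matrix.diagonal D) =
      !![D 0, 0, 0; 0, D 1 + σ z * D 2 * z, σ z * D 2 * ϖ ^ s; 0, σ (ϖ ^ s) * D 2 * z, σ (ϖ ^ s) * D 2 * ϖ ^ s] := by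
    rw [formCongr_hnf_diagonal σ D 0 0 z 1 (ϖ ^ s) g rfl]
    ext i j
    fin_cases i <;> fin_cases j <;> simp
  obtain ⟨hint, hinv, hdet⟩ := (isVertexLattice_latt_iff_of_v σ hvσ hϖ0 (Matrix.diagonal D) 2 g).1 hV
  have hΔ0 : D 1 * D 2 * (σ (ϖ ^ s) * ϖ ^ s) ≠ 0 :=
    mul_ne_zero (mul_ne_zero (hD 1).2 (hD 2).2) (mul_ne_zero ((map_ne_zero σ).2 (pow_ne_zero _ hϖ0)) (pow_ne_zero _ hϖ0))
  have hdet' : (-(s : ℤ)) + (2 * n₀ + 2 * n₁ + 2 * n₂) + (-(s : ℤ)) = -1 + -1 := by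
    have h := hdet
    rw [det_formCongr_diagonal σ D g, det_coe_hnf 0 0 z 1 (ϖ ^ s) g rfl, one_mul, map_mul, map_mul, map_mul, map_mul, hσs, hn₀, hn₁, hn₂, hvs, hϖ,
      ← WithZero.exp_add, ← WithZero.exp_add, ← WithZero.exp_add, ← WithZero.exp_add, pow_two, ← WithZero.exp_add, WithZero.exp_inj] at h
    exact h
  have h12 : Valued.v (σ z * D 2 * ϖ ^ s) ≤ 1 := by have h := hint 1 2; rw [hG] at h; exact h
  have h11 : Valued.v (D 1 + σ z * D 2 * z) ≤ 1 := by have h := hint 1 1; rw [hG] at h; exact h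
  have h00 : Valued.v (D 0) ≤ 1 := by have h := hint 0 0; rw [hG] at h; exact h
  have hGinv : (formCongr σ g (Matrix.diagonal D))⁻¹ =
      !![(D 0)⁻¹, 0, 0;
         0, σ (ϖ ^ s) * D 2 * ϖ ^ s / (D 1 * D 2 * (σ (ϖ ^ s) * ϖ ^ s)), -(σ z * D 2 * ϖ ^ s) / (D 1 * D 2 * (σ (ϖ ^ s) * ϖ ^ s));
         0, -(σ (ϖ ^ s) * D 2 * z) / (D 1 * D 2 * (σ (ϖ ^ s) * ϖ ^ s)), (D 1 + σ z * D 2 * z) / (D 1 * D 2 * (σ (ϖ ^ s) * ϖ ^ s))] := by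
    rw [hG]
    refine Matrix.inv_eq_right_inv ?_
    have h0 := (hD 0).2
    have h1 := (hD 1).2
    have h2 := (hD 2).2
    have hs0 : σ (ϖ ^ s) ≠ 0 := (map_ne_zero σ).2 (pow_ne_zero _ hϖ0)
    have hσϖ : σ ϖ ≠ 0 := (map_ne_zero σ).2 hϖ0
    have hp0 : (ϖ ^ s : K) ≠ 0 := pow_ne_zero _ hϖ0
    ext i j
    fin_cases i <;> fin_cases j <;> simp [Matrix.mul_apply, Fin.sum_univ_three] <;> field_simp <;> ring
  have i00 : Valued.v (ϖ * (D 0)⁻¹) ≤ 1 := by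
    have h := hinv 0 0; rw [hGinv, Matrix.smul_apply, smul_eq_mul] at h; exact h
  have i21 : Valued.v (ϖ * (-(σ (ϖ ^ s) * D 2 * z) / (D 1 * D 2 * (σ (ϖ ^ s) * ϖ ^ s)))) ≤ 1 := by
    have h := hinv 2 1; rw [hGinv, Matrix.smul_apply, smul_eq_mul] at h; exact h
  have i22 : Valued.v (ϖ * ((D 1 + σ z * D 2 * z) / (D 1 * D 2 * (σ (ϖ ^ s) * ϖ ^ s)))) ≤ 1 := by
    have h := hinv 2 2; rw [hGinv, Matrix.smul_apply, smul_eq_mul] at h; exact h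
  have hΔpos : 0 < Valued.v (D 1 * D 2 * (σ (ϖ ^ s) * ϖ ^ s)) := (Valuation.pos_iff _).2 hΔ0
  have vΔ : Valued.v (D 1 * D 2 * (σ (ϖ ^ s) * ϖ ^ s)) = WithZero.exp (2 * n₁ + 2 * n₂ + (-(s : ℤ) + -(s : ℤ))) := by
    rw [map_mul, map_mul, map_mul, hn₁, hn₂, hσs, hvs, ← WithZero.exp_add, ← WithZero.exp_add, ← WithZero.exp_add]
  have e00 : n₀ = 0 := by
    rw [hn₀, ← WithZero.exp_zero, WithZero.exp_le_exp] at h00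
    rw [map_mul, map_inv₀, hϖ, hn₀, ← WithZero.exp_neg, ← WithZero.exp_add, ← WithZero.exp_zero, WithZero.exp_le_exp] at i00
    omega
  have e12 : 2 * n₂ - (s : ℤ) ≤ 0 := by
    rw [map_mul, map_mul, hσz, one_mul, hn₂, hvs, ← WithZero.exp_add, ← WithZero.exp_zero, WithZero.exp_le_exp] at h12
    omega
  have e21 : (s : ℤ) - 1 ≤ 2 * n₁ := by
    rw [map_mul, map_div₀, ← mul_div_assoc, div_le_one₀ hΔpos, Valuation.map_neg, map_mul, map_mul, hσs, hn₂, hz, mul_one, hϖ, vΔ,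
      ← WithZero.exp_add, ← WithZero.exp_add, WithZero.exp_le_exp] at i21
    omega
  obtain ⟨m, rfl⟩ : ∃ m, s = 2 * m + 1 := ⟨s / 2, by omega⟩
  -- `n₁ = m`: otherwise `n₁ > n₂`, `|G₁₁| = |D₁| ≤ 1` forces `n₁ ≤ 0 < m + 1 ≤ n₁`
  have hn₁m : n₁ = (m : ℤ) := by
    by_contra hne
    have hlt : Valued.v (σ z * D 2 * z) < Valued.v (D 1) := by
      rw [map_mul, map_mul, hσz, hz, one_mul, mul_one, hn₂, hn₁, WithZero.exp_lt_exp]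
      push_cast at hdet' e12 e21
      omega
    have e11 : n₁ ≤ 0 := by
      rw [Valuation.map_add_eq_of_lt_left _ hlt, hn₁, ← WithZero.exp_zero, WithZero.exp_le_exp] at h11
      omega
    push_cast at hdet' e12 e21
    omega
  have hn₂m : n₂ = (m : ℤ) := by push_cast at hdet'; omega
  refine ⟨hodd, ?_, ?_, ?_, ?_⟩
  · rw [hn₀, e00, mul_zero, WithZero.exp_zero]
  · rw [hn₁, hn₁m]; push_cast; ring_nf
  · rw [hn₂, hn₂m]; push_cast; ring_nf
  · -- `|ϖ·G₁₁| ≤ |Δ| = exp(−2)`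
    rw [map_mul, map_div₀, ← mul_div_assoc, div_le_one₀ hΔpos, hϖ, vΔ, hn₁m, hn₂m] at i22
    rcases eq_or_ne (D 1 + σ z * D 2 * z) 0 with h0 | h0
    · rw [h0, map_zero]; exact zero_le
    · obtain ⟨k, hk⟩ : ∃ k : ℤ, Valued.v (D 1 + σ z * D 2 * z) = WithZero.exp k :=
        ⟨_, (WithZero.coe_unzero ((Valuation.ne_zero_iff _).2 h0)).symm⟩
      rw [hk, ← WithZero.exp_add, WithZero.exp_le_exp] at i22
      rw [hk, WithZero.exp_le_exp]
      push_cast at i22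
      omega

/-! ## §2  Uniqueness: two type-2 polarisations differ by an element of `S_F(M₁(s,z))` -/

/-- **B9-0₂ UNIQUENESS ON THE AXIS-1 STRATUM.**  If `diag(D₁)` and `diag(D)` are two `σ`-fixed non-degenerate diagonal forms for which `M₁(s,z)` (`z` a unit) is a type-2 vertex
lattice, then `D = D₁·u` for some `u ∈ S_F(M₁(s,z))` (`u = D∕D₁` is a fixed unit vector by §1, and `|u₂ − u₁| ≤ |ϖ|^s` from the two `G₁₁`-bounds) — the polarisations form ONE
`S_F`-coset, `n₂ = 1` (MEMO v2.1 §T2.2, `T₁(s)`). [cite: Kottwitz1986BaseChangeUnits, §1 pp. 240–241] [cite: Rogawski1990, §4.9 Prop. 4.9.1 (a) p. 55] -/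
theorem typeTwoPolarisation_unique_latt_axis1 {σ : K →+* K} (hvσ : ∀ a, Valued.v (σ a) = Valued.v a)
    (hfix : ∀ x : K, σ x = x → x ≠ 0 → ∃ n : ℤ, Valued.v x = WithZero.exp (2 * n)) {ϖ : K} (hϖ : Valued.v ϖ = WithZero.exp (-1 : ℤ))
    {z : K} (hz : Valued.v z = 1) {s : ℕ} (D₁ D : Fin 3 → K) (hD₁ : ∀ i, σ (D₁ i) = D₁ i ∧ D₁ i ≠ 0)
    (hV₁ : IsVertexLattice σ ϖ (Matrix.diagonal D₁) 2 (latt (!![1, 0, 0; 0, 1, 0; 0, z, ϖ ^ s] : Matrix (Fin 3) (Fin 3) K)))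
    (hD : ∀ i, σ (D i) = D i ∧ D i ≠ 0) (hV : IsVertexLattice σ ϖ (Matrix.diagonal D) 2 (latt (!![1, 0, 0; 0, 1, 0; 0, z, ϖ ^ s] : Matrix (Fin 3) (Fin 3) K))) :
    ∃ u ∈ fixedUnitStabilizer σ (latt (!![1, 0, 0; 0, 1, 0; 0, z, ϖ ^ s] : Matrix (Fin 3) (Fin 3) K)), ∀ i, D i = D₁ i * (u i : K) := by
  have hϖ0 : ϖ ≠ 0 := fun h0 => by rw [h0, map_zero] at hϖ; exact WithZero.coe_ne_zero hϖ.symm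
  have hvs : Valued.v (ϖ ^ s) = WithZero.exp (-(s : ℤ)) := by rw [map_pow, v_varpi_pow hϖ]
  obtain ⟨-, e₀, e₁, e₂, g₁⟩ := exponents_of_isVertexLattice_two_latt_axis1 hvσ hfix hϖ hz hD₁ hV₁
  obtain ⟨-, f₀, f₁, f₂, g⟩ := exponents_of_isVertexLattice_two_latt_axis1 hvσ hfix hϖ hz hD hV
  -- the quotient `u = D ∕ D₁`, a `σ`-fixed unit vector
  have hval : ∀ i, Valued.v (D i / D₁ i) = 1 := by
    intro i
    rw [map_div₀]
    fin_cases i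
    · show Valued.v (D 0) / Valued.v (D₁ 0) = 1; rw [f₀, e₀, div_one]
    · show Valued.v (D 1) / Valued.v (D₁ 1) = 1; rw [f₁, e₁, div_self (WithZero.coe_ne_zero)]
    · show Valued.v (D 2) / Valued.v (D₁ 2) = 1; rw [f₂, e₂, div_self (WithZero.coe_ne_zero)]
  have hne : ∀ i, D i / D₁ i ≠ 0 := fun i => div_ne_zero (hD i).2 (hD₁ i).2
  refine ⟨fun i => Units.mk0 (D i / D₁ i) (hne i), ?_, fun i => ?_⟩
  · rw [mem_fixedUnitStabilizer_latt_axis1_iff σ hϖ0 hz s]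
    refine ⟨(mem_fixedUnitTorus_iff σ _).2 ⟨fun i => by rw [Units.val_mk0]; exact hval i, fun i => by
      rw [Units.val_mk0, map_div₀, (hD i).1, (hD₁ i).1]⟩, ?_⟩
    -- `(u₂ − u₁)·D₁,₁·D₁,₂ = D₁,₁·D 2 − D 1·D₁,₂ = D 2·g₁ − g·D₁,₂`
    show Valued.v (D 2 / D₁ 2 - D 1 / D₁ 1) ≤ Valued.v (ϖ ^ s)
    have h11 := (hD₁ 1).2
    have h12 := (hD₁ 2).2
    have key : D 2 / D₁ 2 - D 1 / D₁ 1 = (D 2 * (D₁ 1 + σ z * D₁ 2 * z) - (D 1 + σ z * D 2 * z) * D₁ 2) / (D₁ 1 * D₁ 2) := by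
      field_simp
      ring
    rw [key, map_div₀, map_mul, e₁, e₂, ← WithZero.exp_add, hvs]
    have hnum : Valued.v (D 2 * (D₁ 1 + σ z * D₁ 2 * z) - (D 1 + σ z * D 2 * z) * D₁ 2) ≤ WithZero.exp ((s : ℤ) - 1 + -1) := by
      refine (Valuation.map_sub _ _ _).trans (max_le ?_ ?_)
      · rw [map_mul, f₂, WithZero.exp_add]; exact mul_le_mul_right g₁ _
      · rw [map_mul, e₂, mul_comm, WithZero.exp_add]; exact mul_le_mul_right g _
    rw [div_le_iff₀ (WithZero.zero_lt_coe _), ← WithZero.exp_add]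
    refine hnum.trans ?_
    rw [WithZero.exp_le_exp]; omega
  · rw [Units.val_mk0, mul_div_cancel₀ _ (hD₁ i).2]

/-! ## §3  The socket forms: uniqueness for every lattice of axis vector `(0,s,s)`, and on `stratumTwo σ ϖ T (0,s,s)` -/

/-- **B9-0₂ UNIQUENESS, AXIS VECTOR `(0,s,s)`** (`s ≥ 1`): for every normalised `T`-stable lattice `M` with `M ∩ K·eᵢ = 𝔭^{(0,s,s)ᵢ}eᵢ` — by ★ `hasAxis_axis1_iff` these are
exactly the `M₁(s,z)`, `z` a unit — two type-2 polarisations differ by an element of `S_F(M)`; the shape LH4-p11 (g2)'s ★ `hcoset_of_forall_unique` consumes, stratum by stratum.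
[cite: Kottwitz1986BaseChangeUnits, §1 pp. 240–241] -/
theorem typeTwoPolarisation_unique_of_hasAxis_T1 {σ : K →+* K} (hvσ : ∀ a, Valued.v (σ a) = Valued.v a)
    (hfix : ∀ x : K, σ x = x → x ≠ 0 → ∃ n : ℤ, Valued.v x = WithZero.exp (2 * n)) {ϖ : K} (hϖ : Valued.v ϖ = WithZero.exp (-1 : ℤ))
    {T : GL (Fin 3) K} {M : Submodule 𝒪[K] (Fin 3 → K)} (hM : M ∈ normalisedStableLattices T) {s : ℕ} (hs : 1 ≤ s) (ha : HasAxis ϖ M ![0, s, s])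
    (D₁ D : Fin 3 → K) (hD₁ : ∀ i, σ (D₁ i) = D₁ i ∧ D₁ i ≠ 0) (hV₁ : IsVertexLattice σ ϖ (Matrix.diagonal D₁) 2 M)
    (hD : ∀ i, σ (D i) = D i ∧ D i ≠ 0) (hV : IsVertexLattice σ ϖ (Matrix.diagonal D) 2 M) :
    ∃ u ∈ fixedUnitStabilizer σ M, ∀ i, D i = D₁ i * (u i : K) := by
  obtain ⟨z, hz, rfl⟩ := (hasAxis_axis1_iff hϖ hM hs).1 ha
  exact typeTwoPolarisation_unique_latt_axis1 hvσ hfix hϖ hz D₁ D hD₁ hV₁ hD hV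

/-- **B9-0₂ UNIQUENESS ON `stratumTwo σ ϖ T (0,s,s)`** (`s ≥ 1`): the same, indexed by the ★ StrataDefs ED. 2 type-2 stratum of the B10₂ partition.
[cite: Kottwitz1986BaseChangeUnits, §1 pp. 240–241] -/
theorem typeTwoPolarisation_unique_stratumTwo_T1 {σ : K →+* K} (hvσ : ∀ a, Valued.v (σ a) = Valued.v a)
    (hfix : ∀ x : K, σ x = x → x ≠ 0 → ∃ n : ℤ, Valued.v x = WithZero.exp (2 * n)) {ϖ : K} (hϖ : Valued.v ϖ = WithZero.exp (-1 : ℤ))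
    {T : GL (Fin 3) K} {s : ℕ} (hs : 1 ≤ s) {M : Submodule 𝒪[K] (Fin 3 → K)} (hM : M ∈ stratumTwo σ ϖ T ![0, s, s])
    (D₁ D : Fin 3 → K) (hD₁ : ∀ i, σ (D₁ i) = D₁ i ∧ D₁ i ≠ 0) (hV₁ : IsVertexLattice σ ϖ (Matrix.diagonal D₁) 2 M)
    (hD : ∀ i, σ (D i) = D i ∧ D i ≠ 0) (hV : IsVertexLattice σ ϖ (Matrix.diagonal D) 2 M) :
    ∃ u ∈ fixedUnitStabilizer σ M, ∀ i, D i = D₁ i * (u i : K) :=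
  typeTwoPolarisation_unique_of_hasAxis_T1 hvσ hfix hϖ hM.1 hs hM.2.2 D₁ D hD₁ hV₁ hD hV

end Summit.HodgeConjecture.HodgeConjecture.Cruxes.H413.F0P3cDyRamDiagonalSplitCountTwoUniqueAxisOne

end
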